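import Mathlib.Data.Nat.Factorization.Basic
import Mathlib.RingTheory.Coprime.Lemmas
import Mathlib.Tactic.Ring
import Mathlib.Tactic.Linarith
import Mathlib.Tactic.LinearCombination
import HarnessLib

/-!
# Venture HSemireg — LINE LAW, Step 1 in general: a COMMON square root of `m` modulo finitely many moduli (CRT over `lcm`, by
# stripping prime powers) — kernel arithmetic (ENGINE-W code B, card LINE-LAW-B.md §7 Step 1)

HONEST FRAMING. Lean index of the computation cell `pub-hsemireg`, widening group ENGINE-W (code B, seat `engine-w-2`, gen 11). ELEMENTARY
ARITHMETIC in `ℕ` ∕ `ℤ` only (Mathlib's `Nat.factorization`, `ordProj ∕ ordCompl`, `Nat.lcm`); no quadratic field, form, abelian variety,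
sheaf or semiregularity map occurs; nothing here says that HC, HC_CM or HC_AV holds. Theorems only (0 `def`, 0 named fact, 0 `sorry`).
It serves `LineLawPrincipalGenus.lean` ∕ `LineLawRamifiedCapture.lean` (same seat), whose capture theorems take the common root `A` as GIVEN.

SOURCE (card `widen/ENGINE-W/out/probe4/LINE-LAW-B.md` §7, proof Step 1): "for each prime power `p^a ∥ L := lcm(n_j)` we have
`a = v_p(n_{j₀})` for some `j₀` and `m` is a square mod `p^a ⊇ mod n_{j₀}`; by CRT there is `A ∈ ℤ` with `A² ≡ m (mod L)`, i.e.
`n_j ∣ A² − m` for all `j`." KERNEL FORM: if `m` is a square modulo each of finitely many positive moduli, it is a square modulo their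
`lcm` — proved WITHOUT choosing a global factorisation: for two moduli `a, b`, either they are coprime (Bezout CRT), or a prime `p` divides
both and the modulus with the smaller `p`-exponent may be replaced by its prime-to-`p` part without changing the `lcm`'s divisibility
(`lcm a b ∣ lcm a (ordCompl[p] b)` when `v_p b ≤ v_p a`) — strong induction on `a + b`; lists by folding.

WHAT THE KERNEL HOLDS: `root_mul_of_coprime` (coprime CRT, product modulus), `lcm_dvd_lcm_ordCompl` (the stripping step),
**`exists_root_lcm`** (two moduli, `lcm`), `dvd_foldr_lcm` ∕ `foldr_lcm_pos`, **`exists_root_foldr_lcm`**, **`exists_common_root`** (a list of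
positive `ℕ` moduli), **`exists_common_root_int`** (positive `ℤ` moduli — the shape the LINE LAW consumes: the `T∕c_j`). Tier: kernel.
-/

namespace Summit.Ventures.HSemireg.LineLawCommonRoot

/-- **Coprime CRT for roots of `m`** (`ℕ` moduli): roots modulo coprime `a, b` give a root modulo `a·b`. [kernel] -/
theorem root_mul_of_coprime {m : ℤ} {a b : ℕ} (h : Nat.Coprime a b) (ha : ∃ A : ℤ, (a : ℤ) ∣ A ^ 2 - m)
    (hb : ∃ B : ℤ, (b : ℤ) ∣ B ^ 2 - m) : ∃ C : ℤ, ((a * b : ℕ) : ℤ) ∣ C ^ 2 - m := by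
  obtain ⟨A, hA⟩ := ha
  obtain ⟨B, hB⟩ := hb
  have hcop : IsCoprime (a : ℤ) (b : ℤ) := Nat.isCoprime_iff_coprime.2 h
  obtain ⟨u, v, huv⟩ := hcop
  refine ⟨B * u * a + A * v * b, ?_⟩
  push_cast
  refine IsCoprime.mul_dvd ⟨u, v, huv⟩ ?_ ?_
  · have e : (B * u * a + A * v * b) ^ 2 - m
        = (B * u * a + A * v * b - A) * (B * u * a + A * v * b + A) + (A ^ 2 - m) := by ring
    rw [e]
    exact dvd_add (dvd_mul_of_dvd_left ⟨u * (B - A), by linear_combination A * huv⟩ _) hA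
  · have e : (B * u * a + A * v * b) ^ 2 - m
        = (B * u * a + A * v * b - B) * (B * u * a + A * v * b + B) + (B ^ 2 - m) := by ring
    rw [e]
    exact dvd_add (dvd_mul_of_dvd_left ⟨v * (A - B), by linear_combination B * huv⟩ _) hB

/-- **The stripping step**: if a prime `p` has exponent `v_p(b) ≤ v_p(a)`, then `lcm(a, b)` divides `lcm(a, b')` with `b' = ordCompl[p] b`
the prime-to-`p` part of `b` (so a root of `m` modulo `lcm(a, b')` serves for `lcm(a, b)`). [kernel] -/
theorem lcm_dvd_lcm_ordCompl {a b p : ℕ} (hp : p.Prime) (hb : b ≠ 0)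
    (hle : b.factorization p ≤ a.factorization p) : Nat.lcm a b ∣ Nat.lcm a (ordCompl[p] b) := by
  apply Nat.lcm_dvd (Nat.dvd_lcm_left _ _)
  have hsplit : ordProj[p] b * ordCompl[p] b = b := Nat.ordProj_mul_ordCompl_eq_self b p
  have h1 : ordProj[p] b ∣ Nat.lcm a (ordCompl[p] b) :=
    ((pow_dvd_pow p hle).trans (Nat.ordProj_dvd a p)).trans (Nat.dvd_lcm_left _ _)
  have h2 : ordCompl[p] b ∣ Nat.lcm a (ordCompl[p] b) := Nat.dvd_lcm_right _ _
  have hcop : Nat.Coprime (ordProj[p] b) (ordCompl[p] b) := (Nat.coprime_ordCompl hp hb).pow_left _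
  have h3 : ordProj[p] b * ordCompl[p] b ∣ Nat.lcm a (ordCompl[p] b) := Nat.Coprime.mul_dvd_of_dvd_of_dvd hcop h1 h2
  rwa [hsplit] at h3

/-- **Two moduli**: if `m` is a square modulo `a > 0` and modulo `b > 0` then it is a square modulo `lcm(a, b)` (strong induction on
`a + b`: coprime ⇒ CRT; else strip the smaller `p`-part at a common prime `p`). [kernel] -/
theorem exists_root_lcm {m : ℤ} : ∀ (s a b : ℕ), a + b = s → 0 < a → 0 < b →
    (∃ A : ℤ, (a : ℤ) ∣ A ^ 2 - m) → (∃ B : ℤ, (b : ℤ) ∣ B ^ 2 - m) → ∃ C : ℤ, (Nat.lcm a b : ℤ) ∣ C ^ 2 - m := by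
  intro s
  induction s using Nat.strong_induction_on with
  | _ s ih =>
    intro a b hs ha hb hA hB
    by_cases hab : Nat.Coprime a b
    · rw [hab.lcm_eq_mul]
      exact root_mul_of_coprime hab hA hB
    · -- a common prime `p`
      have hg1 : Nat.gcd a b ≠ 1 := hab
      set p := Nat.minFac (Nat.gcd a b) with hp_def
      have hp : p.Prime := Nat.minFac_prime hg1
      have hpa : p ∣ a := (Nat.minFac_dvd _).trans (Nat.gcd_dvd_left a b)
      have hpb : p ∣ b := (Nat.minFac_dvd _).trans (Nat.gcd_dvd_right a b)
      rcases le_total (b.factorization p) (a.factorization p) with hle | hle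
      · -- strip the `p`-part of `b`
        set b' := ordCompl[p] b with hb'_def
        have hb'pos : 0 < b' := Nat.ordCompl_pos p hb.ne'
        have hβ : 0 < b.factorization p := hp.factorization_pos_of_dvd hb.ne' hpb
        have hb'lt : b' < b := Nat.div_lt_self hb (Nat.one_lt_pow hβ.ne' hp.one_lt)
        have hB' : ∃ B : ℤ, (b' : ℤ) ∣ B ^ 2 - m := by
          obtain ⟨B, hB⟩ := hB
          exact ⟨B, (Int.natCast_dvd_natCast.2 (Nat.ordCompl_dvd b p)).trans hB⟩
        obtain ⟨C, hC⟩ := ih (a + b') (by omega) a b' rfl ha hb'pos hA hB'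
        exact ⟨C, (Int.natCast_dvd_natCast.2 (lcm_dvd_lcm_ordCompl hp hb.ne' hle)).trans hC⟩
      · -- strip the `p`-part of `a`
        set a' := ordCompl[p] a with ha'_def
        have ha'pos : 0 < a' := Nat.ordCompl_pos p ha.ne'
        have hα : 0 < a.factorization p := hp.factorization_pos_of_dvd ha.ne' hpa
        have ha'lt : a' < a := Nat.div_lt_self ha (Nat.one_lt_pow hα.ne' hp.one_lt)
        have hA' : ∃ A : ℤ, (a' : ℤ) ∣ A ^ 2 - m := by
          obtain ⟨A, hA⟩ := hA
          exact ⟨A, (Int.natCast_dvd_natCast.2 (Nat.ordCompl_dvd a p)).trans hA⟩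
        obtain ⟨C, hC⟩ := ih (a' + b) (by omega) a' b rfl ha'pos hb hA' hB
        refine ⟨C, (Int.natCast_dvd_natCast.2 ?_).trans hC⟩
        rw [Nat.lcm_comm a b, Nat.lcm_comm a' b]
        exact lcm_dvd_lcm_ordCompl hp ha.ne' hle

/-- Every member of a list divides the folded `lcm`. [kernel] -/
theorem dvd_foldr_lcm {n : ℕ} : ∀ {ns : List ℕ}, n ∈ ns → n ∣ ns.foldr Nat.lcm 1
  | [], h => by simp at h
  | k :: ks, h => by
    rw [List.foldr_cons]
    rcases List.mem_cons.1 h with rfl | h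
    · exact Nat.dvd_lcm_left _ _
    · exact (dvd_foldr_lcm h).trans (Nat.dvd_lcm_right _ _)

/-- The folded `lcm` of positive numbers is positive. [kernel] -/
theorem foldr_lcm_pos : ∀ {ns : List ℕ}, (∀ n ∈ ns, 0 < n) → 0 < ns.foldr Nat.lcm 1
  | [], _ => by simp
  | k :: ks, h => by
    rw [List.foldr_cons]
    exact Nat.pos_of_ne_zero (Nat.lcm_ne_zero (h k (by simp)).ne' (foldr_lcm_pos fun n hn => h n (by simp [hn])).ne')

/-- **Finitely many moduli**: if `m` is a square modulo every member of a list of positive moduli, it is a square modulo their `lcm`.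
[kernel] -/
theorem exists_root_foldr_lcm {m : ℤ} : ∀ (ns : List ℕ), (∀ n ∈ ns, 0 < n ∧ ∃ A : ℤ, (n : ℤ) ∣ A ^ 2 - m) →
    ∃ C : ℤ, ((ns.foldr Nat.lcm 1 : ℕ) : ℤ) ∣ C ^ 2 - m
  | [], _ => ⟨0, by simp⟩
  | k :: ks, h => by
    have hk := h k (by simp)
    have hks : ∀ n ∈ ks, 0 < n ∧ ∃ A : ℤ, (n : ℤ) ∣ A ^ 2 - m := fun n hn => h n (by simp [hn])
    obtain ⟨C, hC⟩ := exists_root_foldr_lcm ks hks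
    rw [List.foldr_cons]
    exact exists_root_lcm _ k (ks.foldr Nat.lcm 1) rfl hk.1 (foldr_lcm_pos fun n hn => (hks n hn).1) hk.2 ⟨C, hC⟩

/-- **STEP 1 of the LINE LAW (card §7)**: if `m` is a square modulo each `n` of a finite list of positive moduli (e.g. because each `n` is
the norm of a PRIMITIVE element of `ℤ[√m]`), there is ONE integer `A` with `n ∣ A² − m` for every `n` in the list. [kernel] -/
theorem exists_common_root {m : ℤ} (ns : List ℕ) (h : ∀ n ∈ ns, 0 < n ∧ ∃ A : ℤ, (n : ℤ) ∣ A ^ 2 - m) :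
    ∃ A : ℤ, ∀ n ∈ ns, (n : ℤ) ∣ A ^ 2 - m := by
  obtain ⟨C, hC⟩ := exists_root_foldr_lcm ns h
  exact ⟨C, fun n hn => (Int.natCast_dvd_natCast.2 (dvd_foldr_lcm hn)).trans hC⟩

/-- The same for a list of positive INTEGER moduli (the `T∕c_j` of a weight line). [kernel] -/
theorem exists_common_root_int {m : ℤ} (ns : List ℤ) (h : ∀ n ∈ ns, 0 < n ∧ ∃ A : ℤ, n ∣ A ^ 2 - m) :
    ∃ A : ℤ, ∀ n ∈ ns, n ∣ A ^ 2 - m := by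
  have h' : ∀ k ∈ ns.map Int.toNat, 0 < k ∧ ∃ A : ℤ, (k : ℤ) ∣ A ^ 2 - m := by
    intro k hk
    obtain ⟨n, hn, rfl⟩ := List.mem_map.1 hk
    obtain ⟨hn0, A, hA⟩ := h n hn
    refine ⟨by omega, A, ?_⟩
    rwa [Int.toNat_of_nonneg hn0.le]
  obtain ⟨A, hA⟩ := exists_common_root (ns.map Int.toNat) h'
  refine ⟨A, fun n hn => ?_⟩
  have := hA n.toNat (List.mem_map.2 ⟨n, hn, rfl⟩)
  rwa [Int.toNat_of_nonneg (h n hn).1.le] at this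

end Summit.Ventures.HSemireg.LineLawCommonRoot
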